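import Literature.AlgebraicGeometry.Modules.ModuleCechFiniteOfProper
import HarnessLib

/-!
# Finiteness of the module Čech cohomology over a FIELD base: change of base ring along a surjection
# (Görtz–Wedhorn II, Thm. 23.17 / Cor. 23.18; Weibel §1.1)

Topic `AlgebraicGeometry/Modules`; namespace `Literature.AlgebraicGeometry.Modules`.  THEOREMS ONLY (no `def`, no instance,
no notation, no `sorry`).  Cell `hodgecm-mathlib` FLOOR 0, P1 sub-line F-11, packet (iv)∕J3 — the «finiteness sibling» (5) of
F0P1b-p06 (g2)'s (G3) census (input `[Module.Finite k (Ȟⁿ(W₀, 𝒪_{X×X}))]` of the Künneth components on the product cover, F-K3 ★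
`bijective_homologyMap_tensor_cross`).

★ `Modules.module_finite_homology_cechComplex_of_isProper` gives, for `g : X → B` proper over an affine locally noetherian base, the
finiteness of every `Hⁱ(Č•(𝓦, G))` as a module over `Γ(B, 𝒪_B)` through `ρ = g♯`.  The F-J3b ∕ (iv-4) consumers work over a `k`-scheme
`𝒵 : Over (Spec k)` with the base ring `k` itself acting through ★ `Modules.scalarRingHomTop 𝒵 = g♯ ∘ (Γ(Spec k, 𝒪) ≅ k)⁻¹`; the two
module Čech complexes `Č•(𝓦, G)_ρ` (over `A₀`) and `Č•(𝓦, G)_{ρ ∘ τ}` (over `k`, `τ : k → A₀`) have THE SAME cochain groups and the same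
differential, only the scalars differ.  This file transports finiteness along such a change of scalars:

* §1 `module_finite_homology_cechComplex_comp_of_surjective`: for `τ : k →+* A₀` SURJECTIVE, if `Hⁱ(Č•(𝓦, G)_ρ)` is a finite
  `A₀`-module then `Hⁱ(Č•(𝓦, G)_{ρ ∘ τ})` is a finite `k`-module (degrees `≥ 1`: the two complexes are compared through one
  `ℕ`-indexed complex of abelian groups with ★ `HomologyTransfer.homologyAddEquiv`, the scalar `c ∈ k` resp. `τ c ∈ A₀` being the SAME
  cochain endomorphism (★ `homologyAddEquiv_homologyMap_of_smul`), and ★ `Module.Finite.of_addEquiv_semilinear`; degree `0` through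
  ★ `Modules.kerDZeroEquiv`; negative degrees are zero);
* §2 `module_finite_homology_cechComplex_scalarRingHomTop`: for `𝒵 : Over (Spec k)` PROPER, `G` coherent and a finite cover `𝓦` of
  `𝒵` with affine finite intersections, every `Hⁱ(Č•(𝓦, G))` with scalars `k` through `scalarRingHomTop 𝒵` is a finite-dimensional
  `k`-vector space ([GortzWedhorn2023] Cor. 23.18 read in the module Čech dialect over the field).

HC_CM is proved only modulo the 7 printed citations until rung 0 closes; this file is bookkeeping and asserts nothing about HC.

## References
* U. Görtz, T. Wedhorn, *Algebraic Geometry II* (2023), Def. 21.68 (p. 180); Thm. 23.17 and Cor. 23.18 (pp. 306–307). [GortzWedhorn2023]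
* C. A. Weibel, *An introduction to homological algebra* (1994), §1.1 (Def. 1.1.1, Ex. 1.1.2). [Weibel1994]
-/

noncomputable section

open CategoryTheory CategoryTheory.Limits AlgebraicGeometry TopologicalSpace Opposite
open Literature.Algebra.Homology Literature.Algebra.Homology.OrderedCech

set_option backward.isDefEq.respectTransparency false -- `ModuleCat`-valued functors (as in ★ `ModuleCechFiniteOfProper`)

namespace Literature.AlgebraicGeometry.Modules

variable {X : Scheme.{0}} {ι : Type} [LinearOrder ι] (W : ι → X.Opens) (G : X.Modules)
  {k A₀ : Type} [CommRing k] [CommRing A₀] (ρ : A₀ →+* Γ(X, ⊤)) (τ : k →+* A₀)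

/-! ## §0 Plumbing -/

omit [LinearOrder ι] in
/-- The Čech sign `ε(s, a) ∈ A` acts on sections as the INTEGER sign `ε(s, a) ∈ ℤ` (so that it does not see the base ring). [folklore] -/
private theorem sign_smul_eq_int_sign_smul {A : Type} [CommRing A] (ρ' : A →+* Γ(X, ⊤)) {V : X.Opens} [LinearOrder ι]
    (s : Finset ι) (a : ι) (x : SecMod G ρ' V) :
    (OrderedCech.sign A s a • x : SecMod G ρ' V) = OrderedCech.sign ℤ s a • x := by
  unfold OrderedCech.sign
  rw [← Int.cast_smul_eq_zsmul A, Int.cast_pow, Int.cast_neg, Int.cast_one]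

omit [LinearOrder ι] in
/-- `SecMod.val` of an integer multiple. [folklore] -/
private theorem val_zsmul {A : Type} [CommRing A] (ρ' : A →+* Γ(X, ⊤)) {V : X.Opens} (z : ℤ) (x : SecMod G ρ' V) :
    SecMod.val (L := G) (ρ := ρ') (z • x) = z • SecMod.val (L := G) (ρ := ρ') x :=
  map_zsmul (⟨⟨SecMod.val (L := G) (ρ := ρ'), SecMod.val_zero⟩, SecMod.val_add⟩ : SecMod G ρ' V →+ Γ(G, V)) z x

omit [LinearOrder ι] in
/-- `SecMod.val` of a finite sum. [folklore] -/
private theorem val_sum {A : Type} [CommRing A] (ρ' : A →+* Γ(X, ⊤)) {V : X.Opens} {κ : Type*} (t : Finset κ)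
    (f : κ → SecMod G ρ' V) :
    SecMod.val (L := G) (ρ := ρ') (∑ i ∈ t, f i) = ∑ i ∈ t, SecMod.val (L := G) (ρ := ρ') (f i) :=
  map_sum (⟨⟨SecMod.val (L := G) (ρ := ρ'), SecMod.val_zero⟩, SecMod.val_add⟩ : SecMod G ρ' V →+ Γ(G, V)) f t

/-- **`H⁰(Č•(𝓦, G)) ≅ Γ(X, G)` linearly over the base ring** (★ `Modules.kerDZeroEquiv` composed with Mathlib's `ker d⁰ = Z⁰ ≅ H⁰`;
the chain of ★ `module_finite_homology_cechComplex_zero_of_isProper`). [cite: GortzWedhorn2023, Lemma 21.65 (p. 179)] -/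
theorem nonempty_secMod_linearEquiv_homology_zero {A : Type} [CommRing A] (ρ' : A →+* Γ(X, ⊤)) (hcov : ⨆ i, W i = ⊤) :
    Nonempty (SecMod G ρ' ⊤ ≃ₗ[A] (cechComplex W G ρ').homology 0) := by
  let L : CochainComplex (ModuleCat.{0} A) ℤ := cechComplex W G ρ'
  let e₁ : SecMod G ρ' ⊤ ≃ₗ[A] LinearMap.ker (OrderedCech.sysD (sectionsSystem W G ρ') 0) := kerDZeroEquiv W G ρ' hcov
  have hd : L.d 0 1 = ModuleCat.ofHom (OrderedCech.sysD (sectionsSystem W G ρ') 0) := OrderedCech.sysComplex_d _ 0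
  let e₂ : LinearMap.ker (OrderedCech.sysD (sectionsSystem W G ρ') 0) ≃ₗ[A] LinearMap.ker (L.d 0 1).hom :=
    LinearEquiv.ofEq _ _ (by rw [hd]; rfl)
  let e₃ : LinearMap.ker (L.d 0 1).hom ≃ₗ[A] L.cycles 0 := (cyclesIsoKer L 0 1 (by norm_num)).toLinearEquiv.symm
  have h0 : L.d (-1) 0 = 0 :=
    (OrderedCech.isZero_sysComplex_X_of_neg (sectionsSystem W G ρ') (-1) (by norm_num)).eq_of_src _ _
  let e₄ : L.cycles 0 ≃ₗ[A] L.homology 0 := (L.isoHomologyπ (-1) 0 (by simp) h0).toLinearEquiv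
  exact ⟨e₁.trans (e₂.trans (e₃.trans e₄))⟩

/-! ## §1 Change of base ring along a surjection `τ : k → A₀` -/

/-- **Positive degrees.**  For `τ : k →+* A₀` surjective: if `Hⁿ⁺¹(Č•(𝓦, G)_ρ)` is a finite `A₀`-module then
`Hⁿ⁺¹(Č•(𝓦, G)_{ρ ∘ τ})` is a finite `k`-module.  The cochain groups and the differential of the two complexes coincide; one
`ℕ`-indexed complex of abelian groups `K` maps identically onto both (★ `HomologyTransfer.homologyAddEquiv`), and the scalar
`c ∈ k` on the one side is the scalar `τ c ∈ A₀` on the other (★ `homologyAddEquiv_homologyMap_of_smul`), so the composite additive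
bijection `Hⁿ⁺¹_{ρ∘τ} ≃+ Hⁿ⁺¹_ρ` is `τ`-semilinear (★ `Module.Finite.of_addEquiv_semilinear`).
[cite: Weibel1994, §1.1 (Def. 1.1.1, Ex. 1.1.2)] [cite: GortzWedhorn2023, Def. 21.68 (p. 180)] -/
theorem module_finite_homology_cechComplex_comp_succ_of_surjective (hτ : Function.Surjective τ) (n : ℕ)
    [hN : Module.Finite A₀ ((cechComplex W G ρ).homology ((n + 1 : ℕ) : ℤ))] :
    Module.Finite k ((cechComplex W G (ρ.comp τ)).homology ((n + 1 : ℕ) : ℤ)) := by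
  classical
  let C₁ : CochainComplex (ModuleCat.{0} A₀) ℤ := cechComplex W G ρ
  let C₂ : CochainComplex (ModuleCat.{0} k) ℤ := cechComplex W G (ρ.comp τ)
  -- the differentials read as `sysD`
  have hd₁ : ∀ (m : ℕ) (y : OrderedCech.SysCochain (sectionsSystem W G ρ) (m : ℤ)),
      (C₁.d (m : ℤ) ((m + 1 : ℕ) : ℤ)).hom y = OrderedCech.sysD (sectionsSystem W G ρ) (m : ℤ) y := fun m y => by
    change (C₁.d (m : ℤ) ((m : ℤ) + 1)).hom y = _
    rw [OrderedCech.sysComplex_d]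
    rfl
  have hd₂ : ∀ (m : ℕ) (y : OrderedCech.SysCochain (sectionsSystem W G (ρ.comp τ)) (m : ℤ)),
      (C₂.d (m : ℤ) ((m + 1 : ℕ) : ℤ)).hom y = OrderedCech.sysD (sectionsSystem W G (ρ.comp τ)) (m : ℤ) y := fun m y => by
    change (C₂.d (m : ℤ) ((m : ℤ) + 1)).hom y = _
    rw [OrderedCech.sysComplex_d]
    rfl
  -- `d ∘ d = 0` of `C₂`, in `AddCommGrpCat`
  have hdd : ∀ m : ℕ, AddCommGrpCat.ofHom (C₂.d (m : ℤ) ((m + 1 : ℕ) : ℤ)).hom.toAddMonoidHom ≫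
      AddCommGrpCat.ofHom (C₂.d ((m + 1 : ℕ) : ℤ) ((m + 1 + 1 : ℕ) : ℤ)).hom.toAddMonoidHom = 0 := fun m => by
    ext x
    have h := congrArg (fun φ => φ.hom x) (C₂.d_comp_d (m : ℤ) ((m + 1 : ℕ) : ℤ) ((m + 1 + 1 : ℕ) : ℤ))
    simp only [ModuleCat.hom_comp, LinearMap.comp_apply, ModuleCat.hom_zero, LinearMap.zero_apply] at h
    exact h
  -- the `ℕ`-indexed complex of abelian groups underlying `C₂`
  let K : CochainComplex AddCommGrpCat.{0} ℕ :=
    CochainComplex.of (fun m => AddCommGrpCat.of (C₂.X (m : ℤ)))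
      (fun m => AddCommGrpCat.ofHom (C₂.d (m : ℤ) ((m + 1 : ℕ) : ℤ)).hom.toAddMonoidHom) hdd
  have hKd : ∀ m : ℕ, K.d m (m + 1) = AddCommGrpCat.ofHom (C₂.d (m : ℤ) ((m + 1 : ℕ) : ℤ)).hom.toAddMonoidHom := fun m => by
    change CochainComplex.of.d (V := AddCommGrpCat.{0}) (fun m : ℕ => AddCommGrpCat.of (C₂.X (m : ℤ)))
      (fun m : ℕ => AddCommGrpCat.ofHom (C₂.d (m : ℤ) ((m + 1 : ℕ) : ℤ)).hom.toAddMonoidHom) m (m + 1) = _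
    exact CochainComplex.of_d _ _ m
  -- identifications of the cochain groups: `K = C₂` on the nose, `K = C₁` through `SecMod.val`
  let e₂ : ∀ m : ℕ, (K.X m : Type) ≃+ (C₂.X (m : ℤ) : Type) := fun m => AddEquiv.refl _
  let e₁ : ∀ m : ℕ, (K.X m : Type) ≃+ (C₁.X (m : ℤ) : Type) := fun m =>
    { toFun := fun (g : OrderedCech.SysCochain (sectionsSystem W G (ρ.comp τ)) (m : ℤ)) =>
        (fun σ => SecMod.mk (ρ := ρ) (SecMod.val (L := G) (ρ := ρ.comp τ) (g σ)) :
          OrderedCech.SysCochain (sectionsSystem W G ρ) (m : ℤ))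
      invFun := fun (g : OrderedCech.SysCochain (sectionsSystem W G ρ) (m : ℤ)) =>
        (fun σ => SecMod.mk (ρ := ρ.comp τ) (SecMod.val (L := G) (ρ := ρ) (g σ)) :
          OrderedCech.SysCochain (sectionsSystem W G (ρ.comp τ)) (m : ℤ))
      left_inv := fun _ => rfl
      right_inv := fun _ => rfl
      map_add' := fun _ _ => rfl }
  have he₂ : ∀ (m : ℕ) (x : K.X m), e₂ (m + 1) ((K.d m (m + 1)).hom x) = (C₂.d (m : ℤ) ((m + 1 : ℕ) : ℤ)).hom (e₂ m x) :=
    fun m x => by rw [hKd]; rfl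
  have he₁ : ∀ (m : ℕ) (x : K.X m), e₁ (m + 1) ((K.d m (m + 1)).hom x) = (C₁.d (m : ℤ) ((m + 1 : ℕ) : ℤ)).hom (e₁ m x) := by
    intro m x
    rw [hKd]
    change e₁ (m + 1) ((C₂.d (m : ℤ) ((m + 1 : ℕ) : ℤ)).hom x) = _
    rw [hd₁, hd₂]
    funext σ
    apply SecMod.val_injective (L := G) (ρ := ρ)
    change SecMod.val (L := G) (ρ := ρ.comp τ) (OrderedCech.sysD (sectionsSystem W G (ρ.comp τ)) (m : ℤ) x σ) =
      SecMod.val (L := G) (ρ := ρ) (OrderedCech.sysD (sectionsSystem W G ρ) (m : ℤ) (e₁ m x) σ)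
    rw [OrderedCech.sysD_apply, OrderedCech.sysD_apply, val_sum, val_sum]
    refine Finset.sum_congr rfl fun a _ => ?_
    rw [sign_smul_eq_int_sign_smul, sign_smul_eq_int_sign_smul, val_zsmul, val_zsmul]
    rfl
  -- the transfers
  let h₁ : (K.homology (n + 1) : Type) ≃+ (C₁.homology ((n + 1 : ℕ) : ℤ) : Type) := HomologyTransfer.homologyAddEquiv e₁ he₁ n
  let h₂ : (K.homology (n + 1) : Type) ≃+ (C₂.homology ((n + 1 : ℕ) : ℤ) : Type) := HomologyTransfer.homologyAddEquiv e₂ he₂ n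
  refine Module.Finite.of_addEquiv_semilinear τ hτ (h₂.symm.trans h₁) (fun c z => ?_) (hN := hN)
  -- the scalar `c` resp. `τ c` is the cochain endomorphism `ψ` of `K`
  let ψ : K ⟶ K :=
    { f := fun m => AddCommGrpCat.ofHom (DistribSMul.toAddMonoidHom (C₂.X (m : ℤ)) c)
      comm' := by
        intro i j hij
        change i + 1 = j at hij
        subst hij
        rw [hKd]
        ext x
        change (C₂.d (i : ℤ) ((i + 1 : ℕ) : ℤ)).hom (c • x) = c • (C₂.d (i : ℤ) ((i + 1 : ℕ) : ℤ)).hom x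
        exact map_smul _ c x }
  have hψ₂ : ∀ (m : ℕ) (x : K.X m), e₂ m ((ψ.f m).hom x) = c • e₂ m x := fun _ _ => rfl
  have hψ₁ : ∀ (m : ℕ) (x : K.X m), e₁ m ((ψ.f m).hom x) = τ c • e₁ m x := fun _ _ => rfl
  obtain ⟨y, rfl⟩ := h₂.surjective z
  have E₂ : h₂ ((HomologicalComplex.homologyMap ψ (n + 1)).hom y) = c • h₂ y :=
    HomologyTransfer.homologyAddEquiv_homologyMap_of_smul e₂ he₂ hψ₂ n y
  have E₁ : h₁ ((HomologicalComplex.homologyMap ψ (n + 1)).hom y) = τ c • h₁ y :=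
    HomologyTransfer.homologyAddEquiv_homologyMap_of_smul e₁ he₁ hψ₁ n y
  change h₁ (h₂.symm (c • h₂ y)) = τ c • h₁ (h₂.symm (h₂ y))
  rw [← E₂, h₂.symm_apply_apply, h₂.symm_apply_apply, E₁]

/-- **Degree `0`.**  `H⁰ ≅ Γ(X, G)` on both sides (★ `kerDZeroEquiv`, needs the covering `⨆ W = X`); the identity of `Γ(X, G)` is
`τ`-semilinear between the two scalar structures. [cite: GortzWedhorn2023, Lemma 21.65 (p. 179)] [cite: Weibel1994, §1.1 (Ex. 1.1.2)] -/
theorem module_finite_homology_cechComplex_comp_zero_of_surjective (hτ : Function.Surjective τ) (hcov : ⨆ i, W i = ⊤)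
    [hN : Module.Finite A₀ ((cechComplex W G ρ).homology 0)] :
    Module.Finite k ((cechComplex W G (ρ.comp τ)).homology 0) := by
  obtain ⟨f₁⟩ := nonempty_secMod_linearEquiv_homology_zero W G ρ hcov
  obtain ⟨f₂⟩ := nonempty_secMod_linearEquiv_homology_zero W G (ρ.comp τ) hcov
  let j : SecMod G (ρ.comp τ) ⊤ ≃+ SecMod G ρ ⊤ :=
    { toFun := fun x => SecMod.mk (ρ := ρ) (SecMod.val (L := G) (ρ := ρ.comp τ) x)
      invFun := fun x => SecMod.mk (ρ := ρ.comp τ) (SecMod.val (L := G) (ρ := ρ) x)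
      left_inv := fun _ => rfl
      right_inv := fun _ => rfl
      map_add' := fun _ _ => rfl }
  haveI : Module.Finite A₀ (SecMod G ρ ⊤) := Module.Finite.equiv f₁.symm
  haveI : Module.Finite k (SecMod G (ρ.comp τ) ⊤) :=
    Module.Finite.of_addEquiv_semilinear τ hτ j (fun _ _ => rfl)
  exact Module.Finite.equiv f₂

/-- **All degrees** (`hcov` for degree `0`; negative degrees vanish).  [cite: GortzWedhorn2023, Def. 21.68 (p. 180)]
[cite: Weibel1994, §1.1 (Ex. 1.1.2)] -/
theorem module_finite_homology_cechComplex_comp_of_surjective (hτ : Function.Surjective τ) (hcov : ⨆ i, W i = ⊤) (i : ℤ)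
    [Module.Finite A₀ ((cechComplex W G ρ).homology i)] :
    Module.Finite k ((cechComplex W G (ρ.comp τ)).homology i) := by
  by_cases hi : 0 ≤ i
  · obtain ⟨n, rfl⟩ := Int.eq_ofNat_of_zero_le hi
    cases n with
    | zero => exact module_finite_homology_cechComplex_comp_zero_of_surjective W G ρ τ hτ hcov
    | succ n => exact module_finite_homology_cechComplex_comp_succ_of_surjective W G ρ τ hτ n
  · haveI : Subsingleton ((cechComplex W G (ρ.comp τ)).homology i) :=
      ModuleCat.subsingleton_of_isZero (ShortComplex.isZero_homology_of_isZero_X₂ _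
        (OrderedCech.isZero_sysComplex_X_of_neg (sectionsSystem W G (ρ.comp τ)) i (by omega)))
    infer_instance

/-! ## §2 Over a field: `𝒵 : Over (Spec k)` proper, scalars `k` through `scalarRingHomTop 𝒵` -/

/-- **Finiteness of the module Čech cohomology of a coherent module on a PROPER `k`-scheme, scalars `k`** (`k` a field;
`scalarRingHomTop 𝒵 = g♯ ∘ (ΓSpecIso k)⁻¹`, ★ `module_finite_homology_cechComplex_of_isProper` over the affine noetherian base
`Spec k` transported along the surjection `(ΓSpecIso k)⁻¹ : k → Γ(Spec k, 𝒪)` by §1).  This is the instance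
`[Module.Finite k (Ȟⁿ(W₀, 𝒪_{X×X}))]` of the Künneth components on the product cover of an abelian variety.
[cite: GortzWedhorn2023, Thm. 23.17 and Cor. 23.18 (pp. 306–307)] -/
theorem module_finite_homology_cechComplex_scalarRingHomTop {K : Type} [Field K] (𝒵 : Over (Spec (CommRingCat.of K)))
    [IsProper 𝒵.hom] {ι' : Type} [LinearOrder ι'] [Fintype ι'] (𝓦 : ι' → 𝒵.left.Opens) (hcov : ⨆ i, 𝓦 i = ⊤)
    (h𝓦a : ∀ s : Finset ι', s.Nonempty → IsAffineOpen (cechOpen 𝓦 s)) (F : 𝒵.left.Modules) (hF : Morphisms.Coh F) (i : ℤ) :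
    Module.Finite K ((cechComplex 𝓦 F (scalarRingHomTop 𝒵)).homology i) := by
  haveI : Module.Finite Γ(Spec (CommRingCat.of K), ⊤) ((cechComplex 𝓦 F 𝒵.hom.appTop.hom).homology i) :=
    module_finite_homology_cechComplex_of_isProper 𝒵.hom 𝓦 hcov h𝓦a F hF i
  exact module_finite_homology_cechComplex_comp_of_surjective 𝓦 F 𝒵.hom.appTop.hom
    (Scheme.ΓSpecIso (CommRingCat.of K)).inv.hom (Scheme.ΓSpecIso (CommRingCat.of K)).commRingCatIsoToRingEquiv.symm.surjective
    hcov i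

end Literature.AlgebraicGeometry.Modules

end
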